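import Summits.BirchSwinnertonDyer.BirchSwinnertonDyer.Theorems.ByReductionTypeAtTwoMultUpperHalfTowerCert
import Literature.NumberTheory.EllipticCurves.Greenberg1999.ControlLocalKernelAtPMultiplicative
import HarnessLib

/-!
# Route `ByReductionTypeAtTwo`, crux `MultUpperHalfAtTwo` (item stmt-BirchSwinnertonDyer-19922): the TOWER road's constant
# AT THE MULTIPLICATIVE PRIME `2` from PRINT — non-split `C₂ = 4`, split `C₂ = 2^k` with `k ≥ ord₂(log₂ q_E) − 2`
# (Greenberg LNM 1716 §3 pp. 90–93, Literature `Greenberg1999/ControlLocalKernelAtPMultiplicative.lean`, p444017) —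
# plugged into the CERT-currency doors of `…MultUpperHalfTowerCert.lean` (p444347)

HONEST FRAMING (cell `bsd-2adic`, run/shared/lean/pub/bsd-2adic/, seat `bsd-2adic-mult-2` GEN 4, HUMAN RULING D-0074 row (A)):
research route; THEOREMS ONLY (no definition, no new named fact); nothing is booked; BSD is not proved by any of this.
PARTITION: X5@2 mult (K4ᵐ, RESIDUAL-MAP B1·O1; 1 976 book230 classes) × p = 2 — types-the-object-of (the per-class certificate
format of the TOWER road at a multiplicative `2`, both Tate types; habitat = every `E[2]`-irreducible rank-`0` class, 1 673, in
particular the 52 small-image residual classes of the line `four_roads`); closes none. bears_on: K4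
(route-BirchSwinnertonDyer-ByReductionTypeAtTwo item 19922).

WHAT. GEN 3's WANTED (W2) closed: the level-`j'` local kernel bound at the place over `2` for a curve MULTIPLICATIVE at `2`,
displayed as a bare hypothesis in `…MultUpperHalfTower.lean` §3 and as the datum `h2` in `…MultUpperHalfTowerCert.lean`, is
now a NAMED PRINT FACT (D-audit WANTED like hM/hA/hS34):
* non-split: `hNS2 : Greenberg1999.sec3_natCard_localTowerKerPrimary_le_four_nonsplitMultiplicative_two` (p. 93 `|ker(r_v)| ∼ 2c_v`,
  `c_v ∈ {1,2}`, read over the base field `ℚ_n`; `≤ 4` at every layer) ⟹ `h2` with `C₂ = 4` — the SAME constant as a good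
  ordinary `2` (`hS34`), so the feasibility table of tower-1's CERT-SPEC v2 §3 applies verbatim to a non-split multiplicative `2`;
* split: `hSP : Greenberg1999.sec3_natCard_localTowerKerPrimary_splitMultiplicative_rat` (pp. 92–93
  `|ker(r_{v_n})| ∼ log_p(N q_E)/2p[F_v ∩ ℚ_p^cyc : ℚ_p]`, constant in `n`) ⟹ `h2` with `C₂ = 2^k` for any certificate
  `k` with `ord₂(log₂ q_E) ≤ k + 2` (`q_E = Dq.q` the Tate period, `Dq : TateParameterData W 2`; `log₂ q_E ≠ 0` displayed —
  Barré-Sirieix–Diaz–Gramain–Philibert, tree fact `LInvariant_ne_zero`, or read off the same numeric certificate).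
Doors: `towerGapAtTwo_of_layerSelmer_cert_nonsplitTwo` / `…_splitTwo` (the gap), and the UPPER HALF for the class
`missingUpperBoundAt_two_mult_of_layerSelmer_cert_nonsplitTwo` / `…_splitTwo` (GEN 3's class theorem ∘ gap; PRINT {guarded
Thm-4.1 analogue, A236, modularity, GZK, Cassels, Česnavičius, h33g, hM, hA, hNS2 | hSP} + MEMO {hKato K11a RC-2, hGS RC-4} +
CERTIFICATES {P, C, e, k, hlow, hup, arithmetic (, k_q for split)}).

WHAT A PER-CLASS FILE SUPPLIES (mult analogue of tower-1's CHECKLIST, `…TowerLayerCert.lean`): `W = M.baseChange ℚ` minimal;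
ellipticity, global minimality; `Mult W 2` and the Tate type by `Rank1ResidualIntModelReduction.{not_,}hasSplitMultiplicativeReductionAtPrime_of_intModel_of_{noroot,root}`;
`Irr W 2` (cubic with no root mod some `ℓ`); `hr`; `P`/`hP`/`hΔ`/`hC`/`he` (decide); the layer counts `hlow` (`a ≤ d_j`),
`hup` (`d_{j'} ≤ d`) from the tower engines (pilot at a multiplicative `2`: kit j254220, this seat); `harith` (decide); for a
split `2` additionally a Tate datum `Dq` with `log₂ Dq.q ≠ 0` and the valuation certificate `hk`.

References: R. Greenberg, LNM 1716 (1999), §3 pp. 85–94, §4 pp. 112–113; K. Kato, Astérisque 295 (2004), Thm. 17.4, 17.13;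
L. Washington, *Introduction to Cyclotomic Fields*, §13.1–13.2; K. Česnavičius (2018) Thm. 1.2; J. W. S. Cassels (1965);
R. L. Miller, LMS JCM 14 (2011) Def. 1.1.
-/

set_option autoImplicit false
-- the Theorems namespace of this sub repeats the summit name by design (D-0017 nested layout: Summit.<S>.<Sub>)
set_option linter.dupNamespace false

noncomputable section

open scoped Classical MatrixGroups ModularForm

open NumberField IsDedekindDomain CongruenceSubgroup WeierstrassCurve Literature.NumberTheory.EllipticCurves
  Literature.NumberTheory.EllipticCurves.ModularForms
  Literature.NumberTheory.EllipticCurves.Greenberg1999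
  Literature.NumberTheory.EllipticCurves.Rank1Residual
  Literature.NumberTheory.EllipticCurves.Rank1Residual.Typed
  Literature.NumberTheory.GaloisRepresentations
  Summit.BirchSwinnertonDyer.Rank1Residual.X5 Summit.BirchSwinnertonDyer.Rank1Residual.X5.O1
  Summit.BirchSwinnertonDyer.Rank1Residual
  Summit.BirchSwinnertonDyer.BirchSwinnertonDyer.Theorems.KatoHalfPinch

namespace Summit.BirchSwinnertonDyer.BirchSwinnertonDyer.Theorems.MultTowerCert

/-! ## §1 The datum `h2` from PRINT at a multiplicative `2` -/

section AtTwo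

variable (W : WeierstrassCurve ℚ) [W.IsElliptic] [W.IsGloballyMinimal]

/-- **`h2` at a NON-SPLIT multiplicative `2`: `C₂ = 4`** (Greenberg p. 93, `|ker(r_v)| ∼ 2c_v ≤ 4` over every layer's base
field; named fact `hNS2`). [cite: GreenbergLNM1716, §3, between Prop. 3.6 and Prop. 3.7 (PDF p. 93)] -/
theorem atTwo_le_four_of_nonsplit (hNS2 : sec3_natCard_localTowerKerPrimary_le_four_nonsplitMultiplicative_two)
    (hmult : W.HasMultiplicativeReductionAtPrime 2) (hns : ¬ W.HasSplitMultiplicativeReductionAtPrime 2) (n : ℕ) :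
    ∀ κ : ZpExtension ℚ 2, κ.IsCyclotomic → ∀ v : HeightOneSpectrum (𝓞 ℚ), ((2 : ℕ) : 𝓞 ℚ) ∈ v.asIdeal →
      Finite {x : W.localTowerKerPrimary κ (v.adicCompletion ℚ) n // 2 • x = 0} ∧
        Nat.card {x : W.localTowerKerPrimary κ (v.adicCompletion ℚ) n // 2 • x = 0} ≤ 4 :=
  fun κ hκ v hv ↦ pTorsion_le_four_of_sec3_nonsplit_two hNS2 W hmult hns κ hκ v hv n

/-- **`h2` at a SPLIT multiplicative `2`: `C₂ = 2^k` for a certificate `ord₂(log₂ q_E) ≤ k + 2`** (Greenberg pp. 92–93,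
`|ker(r_{v_n})| ∼ log_p(N q_E)/2p[F_v ∩ ℚ_p^cyc : ℚ_p]`; named fact `hSP`; `q_E = Dq.q`).
[cite: GreenbergLNM1716, §3, between Prop. 3.6 and Prop. 3.7 (PDF pp. 92–93)] -/
theorem atTwo_le_pow_of_split (hSP : sec3_natCard_localTowerKerPrimary_splitMultiplicative_rat)
    (Dq : TateParameterData W 2) (hlog : padicLog 2 Dq.q ≠ 0) {k : ℕ}
    (hk : (padicLog 2 Dq.q).valuation ≤ (k : ℤ) + (padicValNat 2 (2 * 2) : ℤ)) (n : ℕ) :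
    ∀ κ : ZpExtension ℚ 2, κ.IsCyclotomic → ∀ v : HeightOneSpectrum (𝓞 ℚ), ((2 : ℕ) : 𝓞 ℚ) ∈ v.asIdeal →
      Finite {x : W.localTowerKerPrimary κ (v.adicCompletion ℚ) n // 2 • x = 0} ∧
        Nat.card {x : W.localTowerKerPrimary κ (v.adicCompletion ℚ) n // 2 • x = 0} ≤ 2 ^ k :=
  fun κ hκ v hv ↦ pTorsion_le_pow_of_sec3_split hSP W 2 Dq hlog hk κ hκ v hv n

/-- `ord₂(4) = 2`: the split certificate reads `ord₂(log₂ q_E) ≤ k + 2`. [folklore] -/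
theorem padicValNat_two_four : padicValNat 2 (2 * 2) = 2 := by
  have : (2 * 2 : ℕ) = 2 ^ 2 := by norm_num
  rw [this, padicValNat.prime_pow]

/-! ## §2 The gap certificate at a multiplicative `2` -/

/-- **The GAP certificate (decidable CERT currency) at a NON-SPLIT multiplicative `2`.** `W/ℚ` globally minimal, non-split
multiplicative at `2`, odd torsion order; PRINT {`h33g`, `hM`, `hA`, `hNS2`}; certificates as in tower-1's CERT-SPEC v2 with the
SAME arithmetic as a good ordinary `2`: `2^d · 4 · ∏_{ℓ ∈ P} C_ℓ^{2^{min(j', e_ℓ)}} < 2^{2^{j'} − 2^j + a}`. Then `O1.TowerGapAtTwo W`.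
[cite: GreenbergLNM1716, §3 Lemmas 3.3–3.5 (PDF pp. 86–90) and pp. 90–93] [cite: SilvermanAEC2009, VII.1 Prop. 1.3, VII.5.1] -/
theorem towerGapAtTwo_of_layerSelmer_cert_nonsplitTwo
    (h33g : lemma33_localTowerKerPrimary_eq_bot_of_good.{0})
    (hM : lemma33_localTowerKerPrimary_cyclic_of_multiplicative.{0})
    (hA : lemma33_natCard_localTowerKerPrimary_le_four_of_additive.{0})
    (hNS2 : sec3_natCard_localTowerKerPrimary_le_four_nonsplitMultiplicative_two)
    (hmult : W.HasMultiplicativeReductionAtPrime 2) (hns : ¬ W.HasSplitMultiplicativeReductionAtPrime 2)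
    (htors : ¬ 2 ∣ W.torsionOrder) {j j' a d : ℕ} (hjj' : j ≤ j')
    (P : Finset ℕ) (hP : ∀ ℓ ∈ P, ℓ.Prime ∧ ℓ ≠ 2)
    (hΔ : ∀ ℓ : ℕ, ℓ.Prime → ℓ ≠ 2 → (ℓ : ℤ) ∣ W.minimalDiscriminantInt → ℓ ∈ P)
    (C e k : ℕ → ℕ) (he : ∀ ℓ ∈ P, ¬ 2 ^ (e ℓ + 4) ∣ ℓ ^ 2 - 1)
    (hC : ∀ (ℓ : ℕ) [Fact ℓ.Prime], ℓ ∈ P →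
      4 ≤ C ℓ ∨ (W.HasMultiplicativeReductionAtPrime ℓ ∧ 2 ≤ C ℓ) ∨
        (W.HasMultiplicativeReductionAtPrime ℓ ∧ (ℓ : ℤ) ^ k ℓ ∣ W.minimalDiscriminantInt ∧
          ¬ (ℓ : ℤ) ^ (k ℓ + 1) ∣ W.minimalDiscriminantInt ∧ ¬ 2 ∣ k ℓ ∧ 1 ≤ C ℓ) ∨
        (¬ (ℓ : ℤ) ∣ W.minimalDiscriminantInt ∧ 1 ≤ C ℓ))
    (hlow : ∀ κ : ZpExtension ℚ 2, κ.IsCyclotomic →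
      2 ^ a ≤ Nat.card {z : W.selmerLayer κ j // 2 • z = 0})
    (hup : ∀ κ : ZpExtension ℚ 2, κ.IsCyclotomic →
      Nat.card {z : W.selmerLayer κ j' // 2 • z = 0} ≤ 2 ^ d)
    (harith : 2 ^ d * 4 * ∏ ℓ ∈ P, C ℓ ^ 2 ^ min j' (e ℓ) < 2 ^ (2 ^ j' - 2 ^ j + a)) :
    TowerGapAtTwo W :=
  towerGapAtTwo_of_layerSelmer_cert_atTwo W h33g hM hA htors hjj' 4 (atTwo_le_four_of_nonsplit W hNS2 hmult hns j')
    P hP hΔ C e k he hC hlow hup harith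

/-- **The GAP certificate (decidable CERT currency) at a SPLIT multiplicative `2`.** As the non-split door with PRINT `hSP` in
place of `hNS2` and ONE more certificate: a Tate datum `Dq` with `log₂ q_E ≠ 0` and `k_q` with `ord₂(log₂ q_E) ≤ k_q + 2`;
arithmetic `2^d · 2^{k_q} · ∏_{ℓ ∈ P} C_ℓ^{2^{min(j', e_ℓ)}} < 2^{2^{j'} − 2^j + a}`.
[cite: GreenbergLNM1716, §3 Lemmas 3.3–3.5 (PDF pp. 86–90) and pp. 90–93] [cite: SilvermanAEC2009, VII.1 Prop. 1.3, VII.5.1] -/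
theorem towerGapAtTwo_of_layerSelmer_cert_splitTwo
    (h33g : lemma33_localTowerKerPrimary_eq_bot_of_good.{0})
    (hM : lemma33_localTowerKerPrimary_cyclic_of_multiplicative.{0})
    (hA : lemma33_natCard_localTowerKerPrimary_le_four_of_additive.{0})
    (hSP : sec3_natCard_localTowerKerPrimary_splitMultiplicative_rat)
    (Dq : TateParameterData W 2) (hlog : padicLog 2 Dq.q ≠ 0) {kq : ℕ}
    (hkq : (padicLog 2 Dq.q).valuation ≤ (kq : ℤ) + 2)
    (htors : ¬ 2 ∣ W.torsionOrder) {j j' a d : ℕ} (hjj' : j ≤ j')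
    (P : Finset ℕ) (hP : ∀ ℓ ∈ P, ℓ.Prime ∧ ℓ ≠ 2)
    (hΔ : ∀ ℓ : ℕ, ℓ.Prime → ℓ ≠ 2 → (ℓ : ℤ) ∣ W.minimalDiscriminantInt → ℓ ∈ P)
    (C e k : ℕ → ℕ) (he : ∀ ℓ ∈ P, ¬ 2 ^ (e ℓ + 4) ∣ ℓ ^ 2 - 1)
    (hC : ∀ (ℓ : ℕ) [Fact ℓ.Prime], ℓ ∈ P →
      4 ≤ C ℓ ∨ (W.HasMultiplicativeReductionAtPrime ℓ ∧ 2 ≤ C ℓ) ∨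
        (W.HasMultiplicativeReductionAtPrime ℓ ∧ (ℓ : ℤ) ^ k ℓ ∣ W.minimalDiscriminantInt ∧
          ¬ (ℓ : ℤ) ^ (k ℓ + 1) ∣ W.minimalDiscriminantInt ∧ ¬ 2 ∣ k ℓ ∧ 1 ≤ C ℓ) ∨
        (¬ (ℓ : ℤ) ∣ W.minimalDiscriminantInt ∧ 1 ≤ C ℓ))
    (hlow : ∀ κ : ZpExtension ℚ 2, κ.IsCyclotomic →
      2 ^ a ≤ Nat.card {z : W.selmerLayer κ j // 2 • z = 0})
    (hup : ∀ κ : ZpExtension ℚ 2, κ.IsCyclotomic →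
      Nat.card {z : W.selmerLayer κ j' // 2 • z = 0} ≤ 2 ^ d)
    (harith : 2 ^ d * 2 ^ kq * ∏ ℓ ∈ P, C ℓ ^ 2 ^ min j' (e ℓ) < 2 ^ (2 ^ j' - 2 ^ j + a)) :
    TowerGapAtTwo W :=
  towerGapAtTwo_of_layerSelmer_cert_atTwo W h33g hM hA htors hjj' (2 ^ kq)
    (atTwo_le_pow_of_split W hSP Dq hlog (by rw [padicValNat_two_four]; exact_mod_cast hkq) j')
    P hP hΔ C e k he hC hlow hup harith

end AtTwo

/-! ## §3 The UPPER HALF for the class, at a multiplicative `2`, from PRINT + MEMO + certificates -/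

section UpperHalf

/-- **ROAD (tower), NON-SPLIT `2` — what a per-class file `…MultTowerClass<label>.lean` applies.** For `W/ℚ` of analytic
rank `0` multiplicative at `2` and a `ℚ`-isogenous globally minimal `E[2]`-IRREDUCIBLE member `W₁` NON-SPLIT multiplicative at
`2`: PRINT {guarded Thm-4.1 analogue `h41ns'`, A236 `h41sp`, `hmod`, `hGZK`, `hCassels`, Česnavičius `hC`, `h33g`, `hM`, `hA`,
`hNS2`} + MEMO {`hKato` K11a Kato `⊗ℚ` at a multiplicative `2` (RC-2), `hGS` Greenberg–Stevens at a split `2` (RC-4; idle at a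
non-split `W₁` but part of GEN 3's class theorem)} + CERTIFICATES {`P`, `C`, `e`, `k`, `hlow`, `hup`, arithmetic with
`C₂ = 4`} ⟹ `MissingUpperBoundAt W 2` at every member. [cite: GreenbergLNM1716, §3 pp. 85–94 and §4 pp. 112–113]
[cite: Washington1997, §13.2] [cite: Cesnavicius2018, Thm. 1.2] [cite: Cassels1965ArithmeticVIII] [cite: Miller2011LMS, Def. 1.1] -/
theorem missingUpperBoundAt_two_mult_of_layerSelmer_cert_nonsplitTwo
    (hKato : ∀ (W : WeierstrassCurve ℚ) [W.IsElliptic] [W.IsGloballyMinimal],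
      ¬ W.HasCM → Mult W 2 → O1.KatoMultiplicativeDivisibilityRat W 2)
    (h41ns' : thm41Analogue_charValue_rankZero_numberField_anyPrime_oddLocalDegree)
    (h41sp : thm41Analogue_charValue_rankZero_split_baseChange_anyPrime)
    (hmod : nonempty_modularParametrizationData)
    (hGZK : rank_eq_analyticRank_of_analyticRank_le_one)
    (hCassels : bsdRHS_eq_of_isIsogenous)
    (hC : cesnavicius_not_two_dvd_maninConstant_of_two_dvd_level)
    (hGS : ∀ (W : WeierstrassCurve ℚ) [W.IsElliptic] [W.IsGloballyMinimal],
      W.HasSplitMultiplicativeReductionAtPrime 2 → greenberg_stevens (W := W) (p := 2))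
    (h33g : lemma33_localTowerKerPrimary_eq_bot_of_good.{0})
    (hM : lemma33_localTowerKerPrimary_cyclic_of_multiplicative.{0})
    (hA : lemma33_natCard_localTowerKerPrimary_le_four_of_additive.{0})
    (hNS2 : sec3_natCard_localTowerKerPrimary_le_four_nonsplitMultiplicative_two)
    (W : WeierstrassCurve ℚ) [W.IsElliptic] [W.IsGloballyMinimal]
    (hr : W.analyticRank = 0) (hmult : Mult W 2)
    (W₁ : WeierstrassCurve ℚ) [W₁.IsElliptic] [W₁.IsGloballyMinimal] (hiso : IsIsogenous W W₁)
    (hirr : Irr W₁ 2) (hmult₁ : W₁.HasMultiplicativeReductionAtPrime 2)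
    (hns₁ : ¬ W₁.HasSplitMultiplicativeReductionAtPrime 2) {j j' a d : ℕ} (hjj' : j ≤ j')
    (P : Finset ℕ) (hP : ∀ ℓ ∈ P, ℓ.Prime ∧ ℓ ≠ 2)
    (hΔ : ∀ ℓ : ℕ, ℓ.Prime → ℓ ≠ 2 → (ℓ : ℤ) ∣ W₁.minimalDiscriminantInt → ℓ ∈ P)
    (C e k : ℕ → ℕ) (he : ∀ ℓ ∈ P, ¬ 2 ^ (e ℓ + 4) ∣ ℓ ^ 2 - 1)
    (hCℓ : ∀ (ℓ : ℕ) [Fact ℓ.Prime], ℓ ∈ P →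
      4 ≤ C ℓ ∨ (W₁.HasMultiplicativeReductionAtPrime ℓ ∧ 2 ≤ C ℓ) ∨
        (W₁.HasMultiplicativeReductionAtPrime ℓ ∧ (ℓ : ℤ) ^ k ℓ ∣ W₁.minimalDiscriminantInt ∧
          ¬ (ℓ : ℤ) ^ (k ℓ + 1) ∣ W₁.minimalDiscriminantInt ∧ ¬ 2 ∣ k ℓ ∧ 1 ≤ C ℓ) ∨
        (¬ (ℓ : ℤ) ∣ W₁.minimalDiscriminantInt ∧ 1 ≤ C ℓ))
    (hlow : ∀ κ : ZpExtension ℚ 2, κ.IsCyclotomic →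
      2 ^ a ≤ Nat.card {z : W₁.selmerLayer κ j // 2 • z = 0})
    (hup : ∀ κ : ZpExtension ℚ 2, κ.IsCyclotomic →
      Nat.card {z : W₁.selmerLayer κ j' // 2 • z = 0} ≤ 2 ^ d)
    (harith : 2 ^ d * 4 * ∏ ℓ ∈ P, C ℓ ^ 2 ^ min j' (e ℓ) < 2 ^ (2 ^ j' - 2 ^ j + a)) :
    MissingUpperBoundAt W 2 :=
  missingUpperBoundAt_two_mult_of_layerSelmer_cert_atTwo hKato h41ns' h41sp hmod hGZK hCassels hC hGS h33g hM hA W hr hmult W₁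
    hiso hirr hjj' 4 (atTwo_le_four_of_nonsplit W₁ hNS2 hmult₁ hns₁ j') P hP hΔ C e k he hCℓ hlow hup harith

/-- **ROAD (tower), SPLIT `2`.** As the non-split class door with PRINT `hSP` in place of `hNS2` and the Tate certificate at
`W₁` (`Dq`, `log₂ q ≠ 0`, `ord₂(log₂ q) ≤ k_q + 2`); arithmetic with `C₂ = 2^{k_q}`.
[cite: GreenbergLNM1716, §3 pp. 85–94 and §4 pp. 112–113] [cite: Washington1997, §13.2] [cite: Cesnavicius2018, Thm. 1.2]
[cite: Cassels1965ArithmeticVIII] [cite: Miller2011LMS, Def. 1.1] -/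
theorem missingUpperBoundAt_two_mult_of_layerSelmer_cert_splitTwo
    (hKato : ∀ (W : WeierstrassCurve ℚ) [W.IsElliptic] [W.IsGloballyMinimal],
      ¬ W.HasCM → Mult W 2 → O1.KatoMultiplicativeDivisibilityRat W 2)
    (h41ns' : thm41Analogue_charValue_rankZero_numberField_anyPrime_oddLocalDegree)
    (h41sp : thm41Analogue_charValue_rankZero_split_baseChange_anyPrime)
    (hmod : nonempty_modularParametrizationData)
    (hGZK : rank_eq_analyticRank_of_analyticRank_le_one)
    (hCassels : bsdRHS_eq_of_isIsogenous)
    (hC : cesnavicius_not_two_dvd_maninConstant_of_two_dvd_level)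
    (hGS : ∀ (W : WeierstrassCurve ℚ) [W.IsElliptic] [W.IsGloballyMinimal],
      W.HasSplitMultiplicativeReductionAtPrime 2 → greenberg_stevens (W := W) (p := 2))
    (h33g : lemma33_localTowerKerPrimary_eq_bot_of_good.{0})
    (hM : lemma33_localTowerKerPrimary_cyclic_of_multiplicative.{0})
    (hA : lemma33_natCard_localTowerKerPrimary_le_four_of_additive.{0})
    (hSP : sec3_natCard_localTowerKerPrimary_splitMultiplicative_rat)
    (W : WeierstrassCurve ℚ) [W.IsElliptic] [W.IsGloballyMinimal]
    (hr : W.analyticRank = 0) (hmult : Mult W 2)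
    (W₁ : WeierstrassCurve ℚ) [W₁.IsElliptic] [W₁.IsGloballyMinimal] (hiso : IsIsogenous W W₁)
    (hirr : Irr W₁ 2) (Dq : TateParameterData W₁ 2) (hlog : padicLog 2 Dq.q ≠ 0) {kq : ℕ}
    (hkq : (padicLog 2 Dq.q).valuation ≤ (kq : ℤ) + 2) {j j' a d : ℕ} (hjj' : j ≤ j')
    (P : Finset ℕ) (hP : ∀ ℓ ∈ P, ℓ.Prime ∧ ℓ ≠ 2)
    (hΔ : ∀ ℓ : ℕ, ℓ.Prime → ℓ ≠ 2 → (ℓ : ℤ) ∣ W₁.minimalDiscriminantInt → ℓ ∈ P)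
    (C e k : ℕ → ℕ) (he : ∀ ℓ ∈ P, ¬ 2 ^ (e ℓ + 4) ∣ ℓ ^ 2 - 1)
    (hCℓ : ∀ (ℓ : ℕ) [Fact ℓ.Prime], ℓ ∈ P →
      4 ≤ C ℓ ∨ (W₁.HasMultiplicativeReductionAtPrime ℓ ∧ 2 ≤ C ℓ) ∨
        (W₁.HasMultiplicativeReductionAtPrime ℓ ∧ (ℓ : ℤ) ^ k ℓ ∣ W₁.minimalDiscriminantInt ∧
          ¬ (ℓ : ℤ) ^ (k ℓ + 1) ∣ W₁.minimalDiscriminantInt ∧ ¬ 2 ∣ k ℓ ∧ 1 ≤ C ℓ) ∨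
        (¬ (ℓ : ℤ) ∣ W₁.minimalDiscriminantInt ∧ 1 ≤ C ℓ))
    (hlow : ∀ κ : ZpExtension ℚ 2, κ.IsCyclotomic →
      2 ^ a ≤ Nat.card {z : W₁.selmerLayer κ j // 2 • z = 0})
    (hup : ∀ κ : ZpExtension ℚ 2, κ.IsCyclotomic →
      Nat.card {z : W₁.selmerLayer κ j' // 2 • z = 0} ≤ 2 ^ d)
    (harith : 2 ^ d * 2 ^ kq * ∏ ℓ ∈ P, C ℓ ^ 2 ^ min j' (e ℓ) < 2 ^ (2 ^ j' - 2 ^ j + a)) :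
    MissingUpperBoundAt W 2 :=
  missingUpperBoundAt_two_mult_of_layerSelmer_cert_atTwo hKato h41ns' h41sp hmod hGZK hCassels hC hGS h33g hM hA W hr hmult W₁
    hiso hirr hjj' (2 ^ kq)
    (atTwo_le_pow_of_split W₁ hSP Dq hlog (by rw [padicValNat_two_four]; exact_mod_cast hkq) j')
    P hP hΔ C e k he hCℓ hlow hup harith

end UpperHalf

end Summit.BirchSwinnertonDyer.BirchSwinnertonDyer.Theorems.MultTowerCert

end
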